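import Literature.MathematicalPhysics.QuantumFieldTheory.Balaban1983to89.StrongCouplingVarianceWindow

/-!
# The tilted moments of `x₀` on `SU(2)` up to tilt `κ = 6/5` (IR-SC lineage, J-SC11 part 1)

observatory of the non-perturbative crossover; no mass-gap claim.

`Literature/…/Balaban1983to89/StrongCouplingVarianceWindow.lean` (R20 of the cell's FRONT-SC) proves, for the
one-link laws `ν_κ ∝ e^{κ x₀} σ` of `SU(2)` with `0 ≤ κ ≤ 1`, the two one-dimensional moment inequalities
`E_κ x₀² ≥ 1/4` and `E_κ (x₀ − κ/4)² ≤ 1/4` behind its variance lemma `integral_var_tilted_le` (`|2 Re tr(g B)| ≤ 1`).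
The restriction `κ ≤ 1` comes only from Mathlib's `Real.exp_bound` (`|x| ≤ 1`).  This file removes it up to
`κ = 6/5`: writing `e^s = (e^{s/2})²` gives `|e^s − (1 + s + s²/2 + s³/6)| ≤ s⁴/15` on `|s| ≤ 6/5`
(`abs_exp_sub_taylor4_le`), and the two inequalities follow for `0 ≤ κ ≤ 6/5` by the same fourth-order Taylor
argument with the exact Haar moments `E x₀² = 1/4`, `E x₀⁴ = 1/8` (R20's `integral_re_quintic`):
`quarter_integral_exp_le_six_fifths`, `integral_shift_sq_mul_exp_le_six_fifths`.  Part 2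
(`StrongCouplingSixFifthsWindow.lean`) turns them into the variance lemma for `|2 Re tr(g B)| ≤ 6/5`, the one-link
KR modulus `√(2c)` on the ball `‖B‖_op ≤ 3/10`, and the strong-coupling doors up to `β_W < √3/9` under the sharp
one-link Poincaré hypothesis `OneLinkPoincareSU2 (3/10) (2/3)`.

Everything here is [folklore] real analysis about Mathlib's Haar probability measure; nothing printed is used or
cited; no number of the cell's ledger changes in this file.
-/

open MeasureTheory Real Finset
open scoped Quaternion
open Literature.MathematicalPhysics.QuantumLattice (su2Quat)
open Literature.MathematicalPhysics.QuantumFieldTheory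
open Literature.MathematicalPhysics.QuantumFieldTheory.Balaban1983to89.StrongCouplingVarianceWindow

noncomputable section

namespace Summit.QuantumFields.BalabanUV.InfraRed.StrongCouplingSixFifthsMoments



/-! ## Part A: the fourth-order Taylor bound for `exp` on `|s| ≤ 6/5` -/

/-- `|e^s − (1 + s + s²/2 + s³/6)| ≤ s⁴/15` for `|s| ≤ 6/5`: write `e^s = (e^{s/2})²` and use Mathlib's
`Real.exp_bound` (valid on `|x| ≤ 1`) at `x = s/2`. [folklore] -/
theorem abs_exp_sub_taylor4_le {s : ℝ} (hs : |s| ≤ 6 / 5) :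
    |exp s - (1 + s + s ^ 2 / 2 + s ^ 3 / 6)| ≤ s ^ 4 / 15 := by
  obtain ⟨hs1, hs2⟩ := abs_le.1 hs
  set x : ℝ := s / 2 with hxdef
  have hsx : s = 2 * x := by rw [hxdef]; ring
  have hx1 : -(3 / 5) ≤ x := by rw [hxdef]; linarith
  have hx2' : x ≤ 3 / 5 := by rw [hxdef]; linarith
  have hx : |x| ≤ 1 := abs_le.2 ⟨by linarith, by linarith⟩
  have hb := Real.exp_bound hx (n := 4) (by norm_num)
  have hsum : ∑ m ∈ range 4, x ^ m / (m.factorial : ℝ) = 1 + x + x ^ 2 / 2 + x ^ 3 / 6 := by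
    simp [Finset.sum_range_succ, Nat.factorial]
  rw [hsum] at hb
  set T : ℝ := 1 + x + x ^ 2 / 2 + x ^ 3 / 6 with hT
  set r : ℝ := exp x - T with hr
  have hx4n : 0 ≤ x ^ 4 := by positivity
  have hr4 : |r| ≤ 5 / 96 * x ^ 4 := by
    refine hb.trans (le_of_eq ?_)
    rw [pow_abs, abs_of_nonneg hx4n]
    norm_num [Nat.factorial]
    ring
  have hx2 : x ^ 2 ≤ (3 / 5) ^ 2 := sq_le_sq' hx1 hx2'
  have hx4 : x ^ 4 ≤ (3 / 5) ^ 2 * (3 / 5) ^ 2 := by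
    have h := mul_le_mul hx2 hx2 (sq_nonneg x) (by norm_num)
    calc x ^ 4 = x ^ 2 * x ^ 2 := by ring
      _ ≤ (3 / 5) ^ 2 * (3 / 5) ^ 2 := h
  have hrabs : |r| ≤ 1 / 100 := by
    have h : 5 / 96 * x ^ 4 ≤ 5 / 96 * ((3 / 5) ^ 2 * (3 / 5) ^ 2) := by linarith
    linarith [hr4, h]
  have hex3 : exp x ≤ 3 := by
    have hd := Real.exp_one_lt_d9
    calc exp x ≤ exp 1 := exp_le_exp.2 (by linarith)
      _ ≤ 3 := by linarith
  have hTabs : |T| ≤ 301 / 100 := by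
    have hTe : T = exp x - r := by rw [hr]; ring
    rw [hTe]
    calc |exp x - r| ≤ |exp x| + |r| := abs_sub _ _
      _ ≤ 3 + 1 / 100 := by rw [abs_of_pos (exp_pos x)]; linarith
      _ = 301 / 100 := by norm_num
  have hexs : exp s = (T + r) ^ 2 := by
    rw [hsx, two_mul, exp_add, hr]
    ring
  have hdec : exp s - (1 + s + s ^ 2 / 2 + s ^ 3 / 6) =
      (7 / 192 * s ^ 4 + s ^ 5 / 192 + s ^ 6 / 2304) + r * (2 * T + r) := by
    rw [hexs, hT, hsx]
    ring
  rw [hdec]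
  have hs4 : 0 ≤ s ^ 4 := by positivity
  have hpoly : |7 / 192 * s ^ 4 + s ^ 5 / 192 + s ^ 6 / 2304| ≤ (7 / 192 + 1 / 160 + 1 / 1600) * s ^ 4 := by
    have h5u : s ^ 5 ≤ 6 / 5 * s ^ 4 := by
      have h := mul_le_mul_of_nonneg_left hs2 hs4
      calc s ^ 5 = s ^ 4 * s := by ring
        _ ≤ s ^ 4 * (6 / 5) := h
        _ = 6 / 5 * s ^ 4 := by ring
    have h5l : -(6 / 5) * s ^ 4 ≤ s ^ 5 := by
      have h := mul_le_mul_of_nonneg_left hs1 hs4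
      calc -(6 / 5) * s ^ 4 = s ^ 4 * -(6 / 5) := by ring
        _ ≤ s ^ 4 * s := h
        _ = s ^ 5 := by ring
    have hsq : s ^ 2 ≤ (6 / 5) ^ 2 := sq_le_sq' (by linarith) hs2
    have h6u : s ^ 6 ≤ (6 / 5) ^ 2 * s ^ 4 := by
      have h := mul_le_mul_of_nonneg_left hsq hs4
      calc s ^ 6 = s ^ 4 * s ^ 2 := by ring
        _ ≤ s ^ 4 * (6 / 5) ^ 2 := h
        _ = (6 / 5) ^ 2 * s ^ 4 := by ring
    have h6l : 0 ≤ s ^ 6 := by positivity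
    rw [abs_le]
    constructor <;> linarith
  have hprod : |r * (2 * T + r)| ≤ 603 / 100 * (5 / 96 * x ^ 4) := by
    rw [abs_mul]
    have h2T : |2 * T + r| ≤ 603 / 100 := by
      calc |2 * T + r| ≤ |2 * T| + |r| := abs_add_le _ _
        _ ≤ 2 * (301 / 100) + 1 / 100 := by rw [abs_mul, abs_two]; linarith
        _ = 603 / 100 := by norm_num
    calc |r| * |2 * T + r| ≤ (5 / 96 * x ^ 4) * (603 / 100) :=
          mul_le_mul hr4 h2T (abs_nonneg _) (by positivity)
      _ = 603 / 100 * (5 / 96 * x ^ 4) := by ring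
  have hx4s : x ^ 4 = s ^ 4 / 16 := by rw [hxdef]; ring
  calc |7 / 192 * s ^ 4 + s ^ 5 / 192 + s ^ 6 / 2304 + r * (2 * T + r)|
      ≤ |7 / 192 * s ^ 4 + s ^ 5 / 192 + s ^ 6 / 2304| + |r * (2 * T + r)| := abs_add_le _ _
    _ ≤ (7 / 192 + 1 / 160 + 1 / 1600) * s ^ 4 + 603 / 100 * (5 / 96 * x ^ 4) := add_le_add hpoly hprod
    _ ≤ s ^ 4 / 15 := by rw [hx4s]; linarith [hs4]

/-- With a bounded prefactor: for `|s| ≤ 6/5` and `|φ| ≤ C`, `|φ e^s − φ (1 + s + s²/2 + s³/6)| ≤ C · s⁴/15`.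
[folklore] -/
theorem abs_mul_exp_sub_taylor4_le {s φ C : ℝ} (hs : |s| ≤ 6 / 5) (hφ : |φ| ≤ C) :
    |φ * exp s - φ * (1 + s + s ^ 2 / 2 + s ^ 3 / 6)| ≤ C * (s ^ 4 / 15) := by
  rw [← mul_sub, abs_mul]
  exact mul_le_mul hφ (abs_exp_sub_taylor4_le hs) (abs_nonneg _) ((abs_nonneg _).trans hφ)

/-! ## Part B: plumbing — continuity and integrability of functions of `x₀` -/

/-- The real coordinate `x₀ = Re U₀₀` is continuous on `SU(2)`. [folklore] -/
theorem continuous_re_su2Quat : Continuous fun g : Matrix.specialUnitaryGroup (Fin 2) ℂ => (su2Quat g).re :=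
  Complex.continuous_re.comp ((continuous_apply_apply 0 0).comp continuous_subtype_val)

/-- Continuous functions of `x₀` are Haar integrable. [folklore] -/
theorem integrable_comp_re {Φ : ℝ → ℝ} (hΦ : Continuous Φ) :
    Integrable (fun g : Matrix.specialUnitaryGroup (Fin 2) ℂ => Φ ((su2Quat g).re)) (haarProbability (Matrix.specialUnitaryGroup (Fin 2) ℂ)) :=
  (hΦ.comp continuous_re_su2Quat).integrable_of_hasCompactSupport (HasCompactSupport.of_compactSpace _)

/-- `|x₀| ≤ 1`. [folklore] -/
theorem abs_re_su2Quat_le_one (g : Matrix.specialUnitaryGroup (Fin 2) ℂ) : |(su2Quat g).re| ≤ 1 := by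
  have h := sq_sum_su2Quat g
  rw [abs_le]
  constructor <;> nlinarith [sq_nonneg (su2Quat g).imI, sq_nonneg (su2Quat g).imJ, sq_nonneg (su2Quat g).imK,
    sq_nonneg ((su2Quat g).re + 1), sq_nonneg ((su2Quat g).re - 1)]

/-- `|κ x₀| ≤ 6/5` for `0 ≤ κ ≤ 6/5`. [folklore] -/
theorem abs_mul_re_le_six_fifths {κ : ℝ} (hκ0 : 0 ≤ κ) (hκ1 : κ ≤ 6 / 5) (g : Matrix.specialUnitaryGroup (Fin 2) ℂ) :
    |κ * (su2Quat g).re| ≤ 6 / 5 := by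
  rw [abs_mul, abs_of_nonneg hκ0]
  calc κ * |(su2Quat g).re| ≤ 6 / 5 * 1 := mul_le_mul hκ1 (abs_re_su2Quat_le_one g) (abs_nonneg _) (by norm_num)
    _ = 6 / 5 := by norm_num

/-! ## Part C: the two one-dimensional tilted-moment inequalities for `0 ≤ κ ≤ 6/5` -/

/-- **Tilted second moment of `x₀` at least the Haar one, up to `κ = 6/5`**:
`(1/4) ∫ e^{κx₀} dσ ≤ ∫ x₀² e^{κx₀} dσ` for `0 ≤ κ ≤ 6/5` (fourth-order Taylor with the exact Haar moments:
`∫ (x₀² − 1/4) e^{κx₀} dσ ≥ κ²/32 − κ⁴/160 ≥ 0`). [folklore] -/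
theorem quarter_integral_exp_le_six_fifths {κ : ℝ} (hκ0 : 0 ≤ κ) (hκ1 : κ ≤ 6 / 5) :
    (1 / 4) * ∫ g, exp (κ * (su2Quat g).re) ∂(haarProbability (Matrix.specialUnitaryGroup (Fin 2) ℂ)) ≤ ∫ g, (su2Quat g).re ^ 2 * exp (κ * (su2Quat g).re) ∂(haarProbability (Matrix.specialUnitaryGroup (Fin 2) ℂ)) := by
  have hpt : ∀ g : Matrix.specialUnitaryGroup (Fin 2) ℂ,
      -1 / 4 + (-κ / 4) * (su2Quat g).re + (1 - κ ^ 2 / 8) * (su2Quat g).re ^ 2 + (κ - κ ^ 3 / 24) * (su2Quat g).re ^ 3 +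
          (κ ^ 2 / 2 - κ ^ 4 / 20) * (su2Quat g).re ^ 4 + (κ ^ 3 / 6) * (su2Quat g).re ^ 5 ≤
        (su2Quat g).re ^ 2 * exp (κ * (su2Quat g).re) - (1 / 4) * exp (κ * (su2Quat g).re) := by
    intro g
    have ht := abs_re_su2Quat_le_one g
    have hφ : |(su2Quat g).re ^ 2 - 1 / 4| ≤ 3 / 4 := by
      have h1 : (su2Quat g).re ^ 2 ≤ 1 := by
        have := abs_le.1 ht
        nlinarith
      rw [abs_le]
      constructor <;> nlinarith [sq_nonneg (su2Quat g).re]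
    have hT := (abs_le.1 (abs_mul_exp_sub_taylor4_le (abs_mul_re_le_six_fifths hκ0 hκ1 g) hφ)).1
    nlinarith [hT]
  have hval := integral_re_quintic (-1 / 4) (-κ / 4) (1 - κ ^ 2 / 8) (κ - κ ^ 3 / 24) (κ ^ 2 / 2 - κ ^ 4 / 20)
    (κ ^ 3 / 6)
  have iP : Integrable (fun g : Matrix.specialUnitaryGroup (Fin 2) ℂ => -1 / 4 + (-κ / 4) * (su2Quat g).re + (1 - κ ^ 2 / 8) * (su2Quat g).re ^ 2 +
      (κ - κ ^ 3 / 24) * (su2Quat g).re ^ 3 + (κ ^ 2 / 2 - κ ^ 4 / 20) * (su2Quat g).re ^ 4 +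
        (κ ^ 3 / 6) * (su2Quat g).re ^ 5) (haarProbability (Matrix.specialUnitaryGroup (Fin 2) ℂ)) :=
    integrable_comp_re (Φ := fun t => -1 / 4 + (-κ / 4) * t + (1 - κ ^ 2 / 8) * t ^ 2 + (κ - κ ^ 3 / 24) * t ^ 3 +
      (κ ^ 2 / 2 - κ ^ 4 / 20) * t ^ 4 + (κ ^ 3 / 6) * t ^ 5) (by fun_prop)
  have i2 : Integrable (fun g : Matrix.specialUnitaryGroup (Fin 2) ℂ => (su2Quat g).re ^ 2 * exp (κ * (su2Quat g).re)) (haarProbability (Matrix.specialUnitaryGroup (Fin 2) ℂ)) :=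
    integrable_comp_re (Φ := fun t => t ^ 2 * exp (κ * t)) (by fun_prop)
  have i0 : Integrable (fun g : Matrix.specialUnitaryGroup (Fin 2) ℂ => (1 / 4) * exp (κ * (su2Quat g).re)) (haarProbability (Matrix.specialUnitaryGroup (Fin 2) ℂ)) :=
    integrable_comp_re (Φ := fun t => (1 / 4) * exp (κ * t)) (by fun_prop)
  have iD : Integrable (fun g : Matrix.specialUnitaryGroup (Fin 2) ℂ => (su2Quat g).re ^ 2 * exp (κ * (su2Quat g).re) -
      (1 / 4) * exp (κ * (su2Quat g).re)) (haarProbability (Matrix.specialUnitaryGroup (Fin 2) ℂ)) := i2.sub i0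
  have hm := integral_mono iP iD fun g => hpt g
  rw [integral_sub i2 i0, integral_const_mul, hval] at hm
  have hκ2 : κ ^ 2 ≤ 36 / 25 := by nlinarith
  nlinarith [sq_nonneg κ, hκ2, mul_nonneg (sq_nonneg κ) (sub_nonneg.2 hκ2)]

/-- **Tilted second moment of `x₀` about `κ/4` at most the Haar variance, up to `κ = 6/5`**:
`∫ (x₀ − κ/4)² e^{κx₀} dσ ≤ (1/4) ∫ e^{κx₀} dσ` for `0 ≤ κ ≤ 6/5` (fourth-order Taylor with the exact Haar
moments: `∫ ((x₀ − κ/4)² − 1/4) e^{κx₀} dσ ≤ −κ²/32 + (451/48000) κ⁴ ≤ 0`). [folklore] -/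
theorem integral_shift_sq_mul_exp_le_six_fifths {κ : ℝ} (hκ0 : 0 ≤ κ) (hκ1 : κ ≤ 6 / 5) :
    ∫ g, ((su2Quat g).re - κ / 4) ^ 2 * exp (κ * (su2Quat g).re) ∂(haarProbability (Matrix.specialUnitaryGroup (Fin 2) ℂ)) ≤ (1 / 4) * ∫ g, exp (κ * (su2Quat g).re) ∂(haarProbability (Matrix.specialUnitaryGroup (Fin 2) ℂ)) := by
  have hpt : ∀ g : Matrix.specialUnitaryGroup (Fin 2) ℂ,
      ((su2Quat g).re - κ / 4) ^ 2 * exp (κ * (su2Quat g).re) - (1 / 4) * exp (κ * (su2Quat g).re) ≤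
        (-1 / 4 + κ ^ 2 / 16) + (-3 * κ / 4 + κ ^ 3 / 16) * (su2Quat g).re +
          (1 - 5 * κ ^ 2 / 8 + κ ^ 4 / 32) * (su2Quat g).re ^ 2 + (κ - 7 * κ ^ 3 / 24 + κ ^ 5 / 96) * (su2Quat g).re ^ 3 +
            (κ ^ 2 / 2 - κ ^ 4 / 12 + 12 / 125 * κ ^ 4) * (su2Quat g).re ^ 4 + (κ ^ 3 / 6) * (su2Quat g).re ^ 5 := by
    intro g
    have ht := abs_re_su2Quat_le_one g
    have hψ : |((su2Quat g).re - κ / 4) ^ 2 - 1 / 4| ≤ 36 / 25 := by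
      obtain ⟨h1, h2⟩ := abs_le.1 ht
      rw [abs_le]
      constructor <;> nlinarith [sq_nonneg ((su2Quat g).re - κ / 4)]
    have hT := (abs_le.1 (abs_mul_exp_sub_taylor4_le (abs_mul_re_le_six_fifths hκ0 hκ1 g) hψ)).2
    nlinarith [hT]
  have hval := integral_re_quintic (-1 / 4 + κ ^ 2 / 16) (-3 * κ / 4 + κ ^ 3 / 16) (1 - 5 * κ ^ 2 / 8 + κ ^ 4 / 32)
    (κ - 7 * κ ^ 3 / 24 + κ ^ 5 / 96) (κ ^ 2 / 2 - κ ^ 4 / 12 + 12 / 125 * κ ^ 4) (κ ^ 3 / 6)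
  have iP : Integrable (fun g : Matrix.specialUnitaryGroup (Fin 2) ℂ => (-1 / 4 + κ ^ 2 / 16) + (-3 * κ / 4 + κ ^ 3 / 16) * (su2Quat g).re +
      (1 - 5 * κ ^ 2 / 8 + κ ^ 4 / 32) * (su2Quat g).re ^ 2 + (κ - 7 * κ ^ 3 / 24 + κ ^ 5 / 96) * (su2Quat g).re ^ 3 +
        (κ ^ 2 / 2 - κ ^ 4 / 12 + 12 / 125 * κ ^ 4) * (su2Quat g).re ^ 4 + (κ ^ 3 / 6) * (su2Quat g).re ^ 5) (haarProbability (Matrix.specialUnitaryGroup (Fin 2) ℂ)) :=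
    integrable_comp_re (Φ := fun t => (-1 / 4 + κ ^ 2 / 16) + (-3 * κ / 4 + κ ^ 3 / 16) * t +
      (1 - 5 * κ ^ 2 / 8 + κ ^ 4 / 32) * t ^ 2 + (κ - 7 * κ ^ 3 / 24 + κ ^ 5 / 96) * t ^ 3 +
        (κ ^ 2 / 2 - κ ^ 4 / 12 + 12 / 125 * κ ^ 4) * t ^ 4 + (κ ^ 3 / 6) * t ^ 5) (by fun_prop)
  have iL : Integrable (fun g : Matrix.specialUnitaryGroup (Fin 2) ℂ => ((su2Quat g).re - κ / 4) ^ 2 * exp (κ * (su2Quat g).re)) (haarProbability (Matrix.specialUnitaryGroup (Fin 2) ℂ)) :=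
    integrable_comp_re (Φ := fun t => (t - κ / 4) ^ 2 * exp (κ * t)) (by fun_prop)
  have i0 : Integrable (fun g : Matrix.specialUnitaryGroup (Fin 2) ℂ => (1 / 4) * exp (κ * (su2Quat g).re)) (haarProbability (Matrix.specialUnitaryGroup (Fin 2) ℂ)) :=
    integrable_comp_re (Φ := fun t => (1 / 4) * exp (κ * t)) (by fun_prop)
  have iD : Integrable (fun g : Matrix.specialUnitaryGroup (Fin 2) ℂ => ((su2Quat g).re - κ / 4) ^ 2 * exp (κ * (su2Quat g).re) -
      (1 / 4) * exp (κ * (su2Quat g).re)) (haarProbability (Matrix.specialUnitaryGroup (Fin 2) ℂ)) := iL.sub i0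
  have hm := integral_mono iD iP fun g => hpt g
  rw [integral_sub iL i0, integral_const_mul, hval] at hm
  have hκ2 : κ ^ 2 ≤ 36 / 25 := by nlinarith
  nlinarith [sq_nonneg κ, hκ2, sq_nonneg (κ ^ 2), mul_nonneg (sq_nonneg κ) (sub_nonneg.2 hκ2)]

end Summit.QuantumFields.BalabanUV.InfraRed.StrongCouplingSixFifthsMoments

end
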